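import Summits.BirchSwinnertonDyer.BirchSwinnertonDyer.Theses.ByReductionTypeAtTwo
import Summits.BirchSwinnertonDyer.Rank1Residual.X5.TwoAdicTargetsEisenstein
import Literature.NumberTheory.EllipticCurves.TwoAdicImageNonSurjectiveFamiliesProofs
import HarnessLib

/-!
# Sketch (gen 2) — crux-ideate on `RankOneAtTwoOffBigImageOddLocal` (item stmt-BirchSwinnertonDyer-23716), ideator 1

Typed first-lemma signatures and small PROVED placement lemmas for the gen-2 idea card
`cubic-cartan-eisenstein-at-two` (stratum γ₁ of half 0: `E(ℚ)[2] = 0` and `Δ ∈ ℚ^{×2}`, i.e. mod-2 image `C3`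
= non-split Cartan; `ℚ(E[2])` is a cyclic cubic field and `E[2] ⊗ 𝔽₄ ≅ ψ ⊕ ψ²` is Eisenstein over `W(𝔽₄)`).
Nothing here proves BSD or the crux.  PROVED: the sign lemmas (`Δ`, `2Δ` square ⇒ `Δ > 0`; `-Δ`, `-2Δ` square ⇒
`Δ < 0`), which place γ₁ and γ₂c inside the slice's `Δ > 0` residual regime (item 24883 `KolyvaginExactAtTwoPosDisc`)
and γ₂a, γ₂d inside its `Δ < 0` regime; `gamma1_not_bigImage` (γ₁ is off the 2-adic big-image locus, from the tree
theorem `not_forall_hasSurjectiveModNGaloisRep_two_pow_iff`); and the restriction `onGamma1_of_crux`.  STATED (Props,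
nothing asserted): `CubicCartanMainConjectureAtTwo` (the transfer target C⁺ of the card: both halves of the cyclotomic
main conjecture at a good ordinary 2 on γ₁, typed through the X5 kernel's `O1.MainConjectureLowerDivisibilityAtTwoOrd` /
`O1.MainConjectureEisensteinDivisibilityAtTwo`) and `RankOneConversionAtTwoOnGamma1` (crux K3 of the card).
-/

noncomputable section

open scoped Classical

namespace Summit.BirchSwinnertonDyer.BirchSwinnertonDyer.Cruxes.RankOneAtTwoOffBigImageOddLocal.SketchG2

open WeierstrassCurve Literature.NumberTheory.EllipticCurves
  Literature.NumberTheory.EllipticCurves.Rank1Residual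
  Summit.BirchSwinnertonDyer.Rank1Residual.X5

/-! ## §1 Sign placement of the γ strata (proved) -/

section sign
variable {W : WeierstrassCurve ℚ} [W.IsElliptic]

private theorem delta_ne_zero : W.Δ ≠ 0 := W.isUnit_Δ.ne_zero

/-- γ₁ (`Δ` a rational square, e.g. mod-2 image `C3`) forces `Δ > 0`: complex conjugation acts trivially on `E[2]`. -/
theorem delta_pos_of_isSquare (h : IsSquare W.Δ) : 0 < W.Δ := by
  obtain ⟨r, hr⟩ := h
  have hr0 : r ≠ 0 := by
    rintro rfl; exact delta_ne_zero (W := W) (by simpa using hr)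
  rw [hr]; exact mul_self_pos.mpr hr0

/-- γ₂c (`2Δ` a rational square) forces `Δ > 0`. -/
theorem delta_pos_of_isSquare_two_mul (h : IsSquare (2 * W.Δ)) : 0 < W.Δ := by
  obtain ⟨r, hr⟩ := h
  have hr0 : r ≠ 0 := by
    rintro rfl
    have : (2 : ℚ) * W.Δ = 0 := by simpa using hr
    exact delta_ne_zero (W := W) (by simpa using this)
  have h2 : 0 < 2 * W.Δ := by rw [hr]; exact mul_self_pos.mpr hr0
  linarith

/-- γ₂a (`-Δ` a rational square) forces `Δ < 0`. -/
theorem delta_neg_of_isSquare_neg (h : IsSquare (-W.Δ)) : W.Δ < 0 := by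
  obtain ⟨r, hr⟩ := h
  have hr0 : r ≠ 0 := by
    rintro rfl
    have : -W.Δ = 0 := by simpa using hr
    exact delta_ne_zero (W := W) (by simpa using this)
  have h2 : 0 < -W.Δ := by rw [hr]; exact mul_self_pos.mpr hr0
  linarith

/-- γ₂d (`-2Δ` a rational square) forces `Δ < 0`. -/
theorem delta_neg_of_isSquare_neg_two_mul (h : IsSquare (-2 * W.Δ)) : W.Δ < 0 := by
  obtain ⟨r, hr⟩ := h
  have hr0 : r ≠ 0 := by
    rintro rfl
    have : -2 * W.Δ = 0 := by simpa using hr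
    exact delta_ne_zero (W := W) (by simpa using this)
  have h2 : 0 < -2 * W.Δ := by rw [hr]; exact mul_self_pos.mpr hr0
  linarith

/-- γ₁ lies OFF the 2-adic big-image locus (the first conjunct of the slice predicate of 23715 fails). -/
theorem gamma1_not_bigImage (h : IsSquare W.Δ) : ¬ ∀ m : ℕ, W.HasSurjectiveModNGaloisRep ((2 ^ m : ℕ) : ℤ) :=
  (not_forall_hasSurjectiveModNGaloisRep_two_pow_iff W).mpr (Or.inr (Or.inl h))

end sign

/-! ## §2 The γ₁ restriction of the crux and the card's typed statements (Props; nothing asserted) -/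

/-- The crux 23716 restricted to γ₁ ∩ {good ordinary at 2}: non-CM, `Δ ∈ ℚ^{×2}`, no rational point of order 2,
good ordinary at 2, analytic rank 1 ⇒ BSD₂.  (On γ₁ ∩ {good at 2} the reduction is automatically ordinary — the
decomposition group at 2 has odd order inside `C3`, so it fixes the ordinary flag; census: 304/304, 0 supersingular.) -/
def OnGamma1GoodOrd : Prop :=
  ∀ (W : WeierstrassCurve ℚ) [W.IsElliptic] [W.IsGloballyMinimal], ¬ W.HasCM → IsSquare W.Δ →
    (∀ P : W.toAffine.Point, 2 • P = 0 → P = 0) → GoodOrd W 2 → W.analyticRank = 1 → BSDp W 2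

/-- The crux implies its γ₁ restriction (γ₁ is off the big-image locus, so the slice conjunction fails). -/
theorem onGamma1_of_crux (h : Theses.ByReductionTypeAtTwo.RankOneAtTwoOffBigImageOddLocal) : OnGamma1GoodOrd := by
  intro W _ _ hCM hΔ _h2 _hord hr
  exact h W hCM (fun hs => gamma1_not_bigImage hΔ hs.1) hr

/-- **Transfer target C⁺ of the card (typed; OPEN; nothing asserted).** On γ₁ ∩ {good ordinary at 2} BOTH halves of
the cyclotomic 2-adic main conjecture hold, in the X5 kernel's Néron normalisation: Kato–Néron lower divisibility
`O1.MainConjectureLowerDivisibilityAtTwoOrd W` and the Eisenstein (upper) divisibility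
`O1.MainConjectureEisensteinDivisibilityAtTwo W`.  The card's mechanism for it: `E[2] ⊗ 𝔽₄ ≅ ψ ⊕ ψ²` (ψ the cubic
character of `ℚ(E[2])`), `f_E ≡ E₂(Ψ, Ψ̄) (mod 𝔪)`, Greenberg–Vatsal residual transport at `p = 2` to `GL₁`
(Greither 1992 Thm. 3.2 = abelian main conjecture incl. `p = 2`; Ferrero–Washington `μ = 0`; Matsuno 2008 §4 at 2;
Kato's `Λ ⊗ ℚ` divisibility at 2). -/
def CubicCartanMainConjectureAtTwo : Prop :=
  ∀ (W : WeierstrassCurve ℚ) [W.IsElliptic] [W.IsGloballyMinimal], ¬ W.HasCM → IsSquare W.Δ →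
    (∀ P : W.toAffine.Point, 2 • P = 0 → P = 0) → GoodOrd W 2 →
      O1.MainConjectureLowerDivisibilityAtTwoOrd W ∧ O1.MainConjectureEisensteinDivisibilityAtTwo W

/-- **Crux K3 of the card (typed; OPEN; nothing asserted): rank-one conversion at 2 on γ₁.** The cyclotomic main
conjecture at a good ordinary 2 converts to BSD₂ in analytic rank ONE on γ₁ (2-adic Gross–Zagier / BDP leg at 2, or
the one-door sandwich with the slice's Kolyvagin inequality and the rank-0 twin). -/
def RankOneConversionAtTwoOnGamma1 : Prop :=
  ∀ (W : WeierstrassCurve ℚ) [W.IsElliptic] [W.IsGloballyMinimal], ¬ W.HasCM → IsSquare W.Δ →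
    (∀ P : W.toAffine.Point, 2 • P = 0 → P = 0) → GoodOrd W 2 →
      O1.MainConjectureLowerDivisibilityAtTwoOrd W → O1.MainConjectureEisensteinDivisibilityAtTwo W →
        W.analyticRank = 1 → BSDp W 2

/-- Assembly on γ₁ ∩ {good ordinary at 2}: C⁺ and the rank-one conversion give the γ₁ restriction of the crux. -/
theorem onGamma1GoodOrd_of (hMC : CubicCartanMainConjectureAtTwo) (hconv : RankOneConversionAtTwoOnGamma1) :
    OnGamma1GoodOrd := by
  intro W _ _ hCM hΔ h2 hord hr
  obtain ⟨hlow, heis⟩ := hMC W hCM hΔ h2 hord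
  exact hconv W hCM hΔ h2 hord hlow heis hr

end Summit.BirchSwinnertonDyer.BirchSwinnertonDyer.Cruxes.RankOneAtTwoOffBigImageOddLocal.SketchG2

end
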